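import Summits.AnomalousDissipation.AnomalousDissipation.Theorems.SolenoidalFractalHomogenisationLagrangianStepPropagatorTranslate
import Summits.AnomalousDissipation.AnomalousDissipation.Theorems.SolenoidalFractalHomogenisationLagrangianStepCellInputsBilinear
import Summits.AnomalousDissipation.AnomalousDissipation.Theorems.SolenoidalFractalHomogenisationLagrangianStepClassReduction
import Literature.Analysis.FunctionSpaces.TorusHolderSobolevEmbedding
import HarnessLib

/-!
# K1L_D (stmt-AnomalousDissipation-27980), line «onelevel-design», brick Z4♭ support: a propagator along a GRID-PERIODIC carrier preserves
# the residue classes of Fourier modes (Bloch sectors) at the OPERATOR level (helper; `--supports … --as helper`; lead-k1l-onelevel-p1 g4)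

For `Torus.IsPropagator T b 𝔸 U` on `V2 = L²(𝕋³; ℝ³)` whose carrier is invariant under the grid `(n⁻¹ℤ)³` (the cell carrier `cellField … n`,
`cell_add_grid`; or the free carrier `0`), the real character average `R_c = Σ_{j ∈ (ℤ/n)³} n⁻³ cos(2π c·j/n) τ_{j/n}` of `…ClassReduction` (a
finite real combination of translations) COMMUTES with every window map `U s t` (`…PropagatorTranslate.map_translate_eq`) and acts on Fourier
coefficients as the multiplier `m_c(k) = ([n ∣ k + c] + [n ∣ k − c])/2` (`ClassReduction.multiplier_eq`).  Hence:
* `fcoeff_pairAvg` — `𝓕(R_c v)(k) = m_c(k) • 𝓕v(k)` on `V2`;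
* `map_pairAvg_eq` — `U s t (R_c x) = R_c (U s t x)`;
* **`fcoeff_apply_eq_zero_of_classes`** — if `𝓕x` vanishes on the conjugate pair of classes `±c + nℤ³`, so does `𝓕(U s t x)`: a window map never
  CREATES content in a Bloch sector pair that the datum does not charge.  For the flat core Z4♭ of the bilinear cut (memo L8 §2) this gives: the
  cell window map from a single slow pair `±ℓ` has no coefficient at any other slow `ℓ'` (`ℓ' ≢ ±ℓ mod N`), and the carrier-free map preserves
  Fourier supports (apply with every `n`).
NOT a proof of any registered stub, of the crux, or of AD; rung F-D1.A0.
-/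

set_option linter.dupNamespace false  -- the summit-side namespace `Summit.AnomalousDissipation.AnomalousDissipation.…` repeats a component by design (D-0017)

noncomputable section

namespace Summit.AnomalousDissipation.AnomalousDissipation.Theorems.SolenoidalFractalHomogenisation.LagrangianStep.PropagatorSymm

open Literature.Analysis Literature.Analysis.FluidPDE Literature.Analysis.FluidPDE.Torus Literature.Analysis.FunctionSpaces
open MeasureTheory Set Filter UnitAddTorus Function
open scoped ENNReal NNReal InnerProductSpace
open OneLevelSplit

variable {n : ℕ}

/-! ## The pair average on `V2` and its multiplier -/

/-- Fourier coefficients of a translate on `V2`: `𝓕(τ_h v)(k) = e_k(h) • 𝓕v(k)`. -/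
theorem fcoeff_translate (h : UnitAddTorus (Fin 3)) (v : V2) (k : Fin 3 → ℤ) :
    mFourierCoeff (EuclideanSpace.complexify ∘
        ⇑(Lp.compMeasurePreserving (fun x : UnitAddTorus (Fin 3) => x + h) (measurePreserving_add_right volume h) v)) k
      = mFourier k h • mFourierCoeff (EuclideanSpace.complexify ∘ ⇑v) k := by
  have hae : (EuclideanSpace.complexify ∘
      ⇑(Lp.compMeasurePreserving (fun x : UnitAddTorus (Fin 3) => x + h) (measurePreserving_add_right volume h) v))
      =ᵐ[volume] fun x => (EuclideanSpace.complexify ∘ ⇑v) (x + h) := by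
    filter_upwards [coeFn_translate h v] with x hx
    simp only [Function.comp_apply, hx]
  rw [FunctionSpaces.Torus.mFourierCoeff_congr_ae hae k]
  exact FunctionSpaces.Torus.mFourierCoeff_comp_add_right (EuclideanSpace.complexify ∘ ⇑v) h k

/-- **Multiplier of the pair average on `V2`**: with `g_j = j/n` and `c_j = n⁻³cos(2π c·j/n)`,
`𝓕(Σ_j c_j • τ_{g_j} v)(k) = (Σ_j c_j e_k(g_j)) • 𝓕v(k)`. -/
theorem fcoeff_pairAvg (c : Fin 3 → ℤ) (v : V2) (k : Fin 3 → ℤ) :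
    mFourierCoeff (EuclideanSpace.complexify ∘ ⇑(∑ j : Fin 3 → Fin n,
        (1 / (n:ℝ) ^ 3 * Real.cos (2 * Real.pi * (∑ i, (c i : ℝ) * ((j i : ℕ) : ℝ)) / n)) •
          Lp.compMeasurePreserving (fun x : UnitAddTorus (Fin 3) => x + (fun i => ((((j i : ℕ) : ℝ) / n : ℝ) : UnitAddCircle)))
            (measurePreserving_add_right volume _) v)) k
      = (∑ j : Fin 3 → Fin n, (((1 / (n:ℝ) ^ 3 * Real.cos (2 * Real.pi * (∑ i, (c i : ℝ) * ((j i : ℕ) : ℝ)) / n)) : ℝ) : ℂ) *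
          mFourier k (fun i => ((((j i : ℕ) : ℝ) / n : ℝ) : UnitAddCircle))) •
        mFourierCoeff (EuclideanSpace.complexify ∘ ⇑v) k := by
  classical
  -- linearity of `𝓕` on `V2` over the finite sum
  have hsum : ∀ (F : Finset (Fin 3 → Fin n)),
      mFourierCoeff (EuclideanSpace.complexify ∘ ⇑(∑ j ∈ F,
        (1 / (n:ℝ) ^ 3 * Real.cos (2 * Real.pi * (∑ i, (c i : ℝ) * ((j i : ℕ) : ℝ)) / n)) •
          Lp.compMeasurePreserving (fun x : UnitAddTorus (Fin 3) => x + (fun i => ((((j i : ℕ) : ℝ) / n : ℝ) : UnitAddCircle)))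
            (measurePreserving_add_right volume _) v)) k
      = ∑ j ∈ F, ((((1 / (n:ℝ) ^ 3 * Real.cos (2 * Real.pi * (∑ i, (c i : ℝ) * ((j i : ℕ) : ℝ)) / n)) : ℝ) : ℂ) *
          mFourier k (fun i => ((((j i : ℕ) : ℝ) / n : ℝ) : UnitAddCircle))) •
        mFourierCoeff (EuclideanSpace.complexify ∘ ⇑v) k := by
    intro F
    induction F using Finset.induction_on with
    | empty => rw [Finset.sum_empty, Finset.sum_empty, fcoeff_zero]
    | insert j F hj ih =>
      rw [Finset.sum_insert hj, Finset.sum_insert hj, fcoeff_add, ih, fcoeff_smul, fcoeff_translate, smul_smul]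
  rw [hsum Finset.univ, Finset.sum_smul]

variable {T : ℝ} {𝔸 : Visc4 (Fin 3)} {lo hi : ℝ} {b : ℝ → VF} {U : ℝ → ℝ → (V2 →L[ℝ] V2)}

/-- **The window maps commute with the pair average** along a grid-periodic carrier. -/
theorem map_pairAvg_eq (hU : IsPropagator T b 𝔸 U) (h𝔸 : NearIso 𝔸 lo hi) (hlo : 0 < lo)
    (hb : MemLp (FunctionSpaces.Torus.stLift b) ∞ (volume.restrict (Ioo 0 T ×ˢ univ)))
    (hbdiv : ∀ᵐ t ∂(volume.restrict (Ioo 0 T)), FunctionSpaces.Torus.IsWeaklyDivFree (b t))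
    (hgrid : ∀ (j : Fin 3 → Fin n) (t : ℝ) (x : UnitAddTorus (Fin 3)), b t (x + (fun i => ((((j i : ℕ) : ℝ) / n : ℝ) : UnitAddCircle))) = b t x)
    (c : Fin 3 → ℤ) {s t : ℝ} (hs : 0 ≤ s) (hst : s ≤ t) (htT : t ≤ T) (x : V2) :
    U s t (∑ j : Fin 3 → Fin n,
        (1 / (n:ℝ) ^ 3 * Real.cos (2 * Real.pi * (∑ i, (c i : ℝ) * ((j i : ℕ) : ℝ)) / n)) •
          Lp.compMeasurePreserving (fun y : UnitAddTorus (Fin 3) => y + (fun i => ((((j i : ℕ) : ℝ) / n : ℝ) : UnitAddCircle)))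
            (measurePreserving_add_right volume _) x)
      = ∑ j : Fin 3 → Fin n,
        (1 / (n:ℝ) ^ 3 * Real.cos (2 * Real.pi * (∑ i, (c i : ℝ) * ((j i : ℕ) : ℝ)) / n)) •
          Lp.compMeasurePreserving (fun y : UnitAddTorus (Fin 3) => y + (fun i => ((((j i : ℕ) : ℝ) / n : ℝ) : UnitAddCircle)))
            (measurePreserving_add_right volume _) (U s t x) := by
  rw [map_sum]
  refine Finset.sum_congr rfl fun j _ => ?_
  rw [map_smul, map_translate_eq hU h𝔸 hlo hb hbdiv _ (hgrid j) hs hst htT x]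

/-- **Class preservation**: if the datum has no coefficient on the conjugate pair of residue classes `{k' : n ∣ k' − c} ∪ {k' : n ∣ k' + c}`
(coordinatewise), then neither has `U s t x` (`0 < n`, grid-periodic carrier, `0 ≤ s ≤ t ≤ T`). -/
theorem fcoeff_apply_eq_zero_of_classes (hU : IsPropagator T b 𝔸 U) (h𝔸 : NearIso 𝔸 lo hi) (hlo : 0 < lo)
    (hb : MemLp (FunctionSpaces.Torus.stLift b) ∞ (volume.restrict (Ioo 0 T ×ˢ univ)))
    (hbdiv : ∀ᵐ t ∂(volume.restrict (Ioo 0 T)), FunctionSpaces.Torus.IsWeaklyDivFree (b t))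
    (hn : 0 < n)
    (hgrid : ∀ (j : Fin 3 → Fin n) (t : ℝ) (x : UnitAddTorus (Fin 3)), b t (x + (fun i => ((((j i : ℕ) : ℝ) / n : ℝ) : UnitAddCircle))) = b t x)
    (c : Fin 3 → ℤ) {s t : ℝ} (hs : 0 ≤ s) (hst : s ≤ t) (htT : t ≤ T) (x : V2)
    (hx : ∀ k' : Fin 3 → ℤ, ((∀ i, (n:ℤ) ∣ k' i - c i) ∨ (∀ i, (n:ℤ) ∣ k' i + c i)) →
      mFourierCoeff (EuclideanSpace.complexify ∘ ⇑x) k' = 0)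
    (k : Fin 3 → ℤ) (hk : (∀ i, (n:ℤ) ∣ k i - c i) ∨ (∀ i, (n:ℤ) ∣ k i + c i)) :
    mFourierCoeff (EuclideanSpace.complexify ∘ ⇑(U s t x)) k = 0 := by
  -- the pair average of `x` vanishes
  have hRx : (∑ j : Fin 3 → Fin n,
        (1 / (n:ℝ) ^ 3 * Real.cos (2 * Real.pi * (∑ i, (c i : ℝ) * ((j i : ℕ) : ℝ)) / n)) •
          Lp.compMeasurePreserving (fun y : UnitAddTorus (Fin 3) => y + (fun i => ((((j i : ℕ) : ℝ) / n : ℝ) : UnitAddCircle)))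
            (measurePreserving_add_right volume _) x) = 0 := by
    refine eq_of_fcoeff_eq fun k' => ?_
    rw [fcoeff_pairAvg, fcoeff_zero]
    by_cases h1 : ∀ i, (n:ℤ) ∣ k' i - c i
    · rw [hx k' (Or.inl h1), smul_zero]
    · by_cases h2 : ∀ i, (n:ℤ) ∣ k' i + c i
      · rw [hx k' (Or.inr h2), smul_zero]
      · rw [ClassReduction.multiplier_eq_zero_off hn c k' h1 h2, zero_smul]
  -- hence the pair average of `U s t x` vanishes, and its multiplier at `k` is nonzero
  have hRU := map_pairAvg_eq hU h𝔸 hlo hb hbdiv hgrid c hs hst htT x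
  rw [hRx, map_zero] at hRU
  have hcoef := congrArg (fun v : V2 => mFourierCoeff (EuclideanSpace.complexify ∘ ⇑v) k) hRU
  rw [fcoeff_zero, fcoeff_pairAvg, ClassReduction.multiplier_eq hn] at hcoef
  -- the multiplier is `1/2` or `1`
  have hm : ((if ∀ i, (n:ℤ) ∣ k i + c i then (1:ℂ) else 0) + (if ∀ i, (n:ℤ) ∣ k i - c i then (1:ℂ) else 0)) / 2 ≠ 0 := by
    rcases hk with hk | hk
    · rw [if_pos hk]; split_ifs <;> norm_num
    · rw [if_pos hk]; split_ifs <;> norm_num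
  exact (smul_eq_zero.1 hcoef.symm).resolve_left hm

end Summit.AnomalousDissipation.AnomalousDissipation.Theorems.SolenoidalFractalHomogenisation.LagrangianStep.PropagatorSymm

end
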